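import Literature.Analysis.FluidPDE.TimePeriodicNSLattice
import Literature.Analysis.Calculus.BorderedImplicitFunction
import HarnessLib

/-!
# Time-periodic Navier–Stokes on `T³` in space–time Fourier coefficients, II: the state space,
# the diagonal operators `ω∂ₛ − νΔ + (m₀·∇)`, the bounded bilinear map, and the bordered
# local-solvability step (Iooss 1972; Henry 1981, Ch. 8; Kielhöfer 2012, §I.8)

Analysis/FluidPDE proof file (theorems only; no definitions, no named facts), sequel of
`TimePeriodicNSLattice` on the discharge path of `Literature.Analysis.FluidPDE.PeriodicNSOrbitPersists`.
On the space–time lattice `𝕃 = ℤ × ℤ³` with the parabolic weight `Λ(n,k) = |n| + |k|²`: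

* §A square-summable families `𝕃 → ℂ³` (Mathlib's `lp`, the bookkeeping of
  `SteadyNSLatticePersistence` §A one dimension up);
* §B the real Hilbert space `W ⊂ ℓ²(𝕃; ℂ³)` of families vanishing on the zero spatial modes
  (`x(n, 0) = 0`: mean-zero fields), transversal (`k · x(n,k) = 0`: divergence free) and conjugate
  symmetric (`x(−m) = conj x(m)`: real fields) — it serves both as the maximal-regularity class
  `X` (an element `x` REPRESENTS `v̂ = x/Λ`, so `‖x‖ ≍ ‖∂ₛv‖_{L²} + ‖Δv‖_{L²}`) and as `Y = L²`;
* §C diagonal (Fourier-multiplier) operators on `W`: a bounded conjugate-symmetric multiplier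
  gives `W →L[ℝ] W`, one bounded below off `k = 0` gives `W ≃L[ℝ] W`; the symbols of
  `∂ₛ` (`2πin/Λ`), `−Δ` (`4π²|k|²/Λ`), the drift `(m₀·∇)` (`2πi(m₀·k)/Λ`) and of
  `L_ω = ω∂ₛ − νΔ + (m₀·∇)`, which is bounded below by a multiple of `Λ` for `ω, ν > 0`, so that
  `L_ω : X → Y` is a linear homeomorphism (Kielhöfer 2012, §I.8, the operator `κ d/dt − A₀`);
* §D the bounded bilinear map `B(x, y) = Π N(x/Λ, y/Λ)` on `W` (`Π` the Leray symbol
  `Torus.lerayCoeff`), from the `L²` estimate `TimePeriodicLattice.tsum_enorm_nl_sq_le`;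
* §E the time-periodic Navier–Stokes map `G(x, ω) = ω ∂ₛx + (−νΔ + m₀·∇) x + B(x, x)` on
  `W × ℝ` and its strict derivative `(h, μ) ↦ μ ∂ₛx₀ + L_{ω₀} h + B(x₀, h) + B(h, x₀)`;
* §F **bordered local solvability**: if `K = B(x₀, ·) + B(·, x₀)` is compact, the kernel of
  `T = L_{ω₀} + K` lies on the line of `g` and `e ∉ range T`, then for every `δ > 0` there is
  `r > 0` such that every right-hand side `y` with `‖y − G(x₀, ω₀)‖ < r` is `G(x, ω)` for some
  `(x, ω)` within `δ` of `(x₀, ω₀)` (the bordering lemma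
  `Literature.Analysis.Calculus.bordered_bijective`, the open mapping theorem and the inverse
  function theorem `SteadyLattice.local_solve`) — the persistence of a nondegenerate
  time-periodic solution under a change of the force, with continuous dependence of solution AND
  frequency, on the Fourier side.

Not here: compactness of `K` for smooth `x₀` and the regularity/dictionary with classical
solutions (sequel files), which turn the hypotheses of §F into the hypotheses (i), (ii) of
`PeriodicNSOrbitPersists`.

## References

* G. Iooss, Arch. Rational Mech. Anal. 47 (1972) 301–329 (time-periodic Navier–Stokes flows by
  implicit-function arguments in spaces of periodic functions). [Iooss1972]
* D. Henry, *Geometric Theory of Semilinear Parabolic Equations*, LNM 840 (1981), Ch. 8 §8.2–8.3.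
  [Henry1981]
* H. Kielhöfer, *Bifurcation Theory*, 2nd ed. (2012), §I.8 (I.8.9)–(I.8.15), Prop. I.8.1
  (PDF pp. 59–60). [Kielhofer2012]
* S.-N. Chow, J. K. Hale, *Methods of Bifurcation Theory* (1982), §2.4 (bordered operators).
  [ChowHale1982]
-/

noncomputable section

open scoped BigOperators Topology ENNReal NNReal ComplexConjugate
open Filter Set Function

namespace Literature.Analysis.FluidPDE

namespace TimePeriodicLattice

open Literature.Analysis.FunctionSpaces Literature.Analysis.FunctionSpaces.Torus
open Literature.Analysis.FunctionSpaces.EuclideanSpace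
open Literature.Analysis.FluidPDE.ScalarFourier

-- BODY START
-- NOTATION START
/-- Local notation: the parabolic weight `Λ(n, k) = |n| + |k|²`. -/
local notation:max "Λ" m:max => (|((Prod.fst m : ℤ) : ℝ)| + freqNormSq (Prod.snd m))

/-- Local notation: the convective symbol on `ℤ × ℤ³` (as in `TimePeriodicNSLattice`). -/
local notation:max "𝐍[" a ", " b "]" m:max =>
  (WithLp.toLp 2 (fun p : Fin 3 => ∑ j : Fin 3, ∑' m' : ℤ × (Fin 3 → ℤ),
    a m' j * (dsym j (Prod.snd m - Prod.snd m') * b (m - m') p)) : EuclideanSpace ℂ (Fin 3))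

/-- Local notation: division by the weight (as in `TimePeriodicNSLattice`). -/
local notation:max "𝐜" x:max => (fun mm : ℤ × (Fin 3 → ℤ) =>
  ((((|((Prod.fst mm : ℤ) : ℝ)| + freqNormSq (Prod.snd mm))⁻¹ : ℝ) : ℂ) • x mm))

/-- Local notation: the family of coefficients `ℤ × ℤ³ → ℂ³` of `x ∈ W ⊂ ℓ²`. -/
local notation:max "𝐰" x:max =>
  (((x : lp (fun _ : ℤ × (Fin 3 → ℤ) => EuclideanSpace ℂ (Fin 3)) 2)) : ℤ × (Fin 3 → ℤ) → EuclideanSpace ℂ (Fin 3))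
-- NOTATION END

open Literature.Analysis.FunctionSpaces.EuclideanSpace

/-! ## §A' Square-summable families on the space–time lattice -/

section L2

/-- Evaluation is bounded by the norm in `ℓ²(𝕃; ℂ³)`. [folklore] -/
theorem l2_norm_apply_le (x : lp (fun _ : ℤ × (Fin 3 → ℤ) => EuclideanSpace ℂ (Fin 3)) 2) (m : ℤ × (Fin 3 → ℤ)) :
    ‖(x : ℤ × (Fin 3 → ℤ) → EuclideanSpace ℂ (Fin 3)) m‖ ≤ ‖x‖ :=
  lp.norm_apply_le_norm two_ne_zero x m

/-- `‖x‖² = ∑ₘ ‖x m‖²` as a convergent series. [folklore] -/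
theorem l2_hasSum_norm_sq (x : lp (fun _ : ℤ × (Fin 3 → ℤ) => EuclideanSpace ℂ (Fin 3)) 2) :
    HasSum (fun m => ‖(x : ℤ × (Fin 3 → ℤ) → EuclideanSpace ℂ (Fin 3)) m‖ ^ 2) (‖x‖ ^ 2) := by
  have h := lp.hasSum_norm (by norm_num : 0 < (2 : ℝ≥0∞).toReal) x
  simpa only [ENNReal.toReal_ofNat, Real.rpow_two] using h

/-- `‖x‖ₑ² = ∑ₘ ‖x m‖ₑ²` in `ℝ≥0∞`. [folklore] -/
theorem l2_enorm_sq_eq_tsum (x : lp (fun _ : ℤ × (Fin 3 → ℤ) => EuclideanSpace ℂ (Fin 3)) 2) :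
    ‖x‖ₑ ^ 2 = ∑' m, ‖(x : ℤ × (Fin 3 → ℤ) → EuclideanSpace ℂ (Fin 3)) m‖ₑ ^ 2 := by
  rw [← ofReal_norm, ← ENNReal.ofReal_pow (norm_nonneg _), ← (l2_hasSum_norm_sq x).tsum_eq,
    ENNReal.ofReal_tsum_of_nonneg (fun m => sq_nonneg _) (l2_hasSum_norm_sq x).summable]
  refine tsum_congr fun m => ?_
  rw [← ofReal_norm, ENNReal.ofReal_pow (norm_nonneg _)]

/-- The `ℓ²` sum of an element is finite. [folklore] -/
theorem l2_tsum_enorm_sq_ne_top (x : lp (fun _ : ℤ × (Fin 3 → ℤ) => EuclideanSpace ℂ (Fin 3)) 2) :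
    ∑' m, ‖(x : ℤ × (Fin 3 → ℤ) → EuclideanSpace ℂ (Fin 3)) m‖ₑ ^ 2 ≠ ∞ := by
  rw [← l2_enorm_sq_eq_tsum]
  exact ENNReal.pow_ne_top enorm_ne_top

/-- A family with `∑ₘ ‖f m‖² < ∞` (in `ℝ≥0∞`) is square summable. [folklore] -/
theorem memℓp_two_of_tsum_ne_top {f : ℤ × (Fin 3 → ℤ) → EuclideanSpace ℂ (Fin 3)} (h : ∑' m, ‖f m‖ₑ ^ 2 ≠ ∞) :
    Memℓp f 2 := by
  rw [memℓp_gen_iff (by norm_num : 0 < (2 : ℝ≥0∞).toReal)]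
  simp only [ENNReal.toReal_ofNat, Real.rpow_two]
  have h' : ∑' m, (((‖f m‖₊ ^ 2 : ℝ≥0)) : ℝ≥0∞) ≠ ∞ := by
    refine fun htop => h ?_
    rw [← htop]
    exact tsum_congr fun m => by simp [enorm_eq_nnnorm]
  have hs := ENNReal.tsum_coe_ne_top_iff_summable.1 h'
  simpa using NNReal.summable_coe.2 hs

/-- The `ℓ²` norm is controlled by any bound on `∑ₘ ‖x m‖ₑ²`. [folklore] -/
theorem l2_enorm_le_of_tsum_le (x : lp (fun _ : ℤ × (Fin 3 → ℤ) => EuclideanSpace ℂ (Fin 3)) 2) {C : ℝ≥0∞}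
    (h : ∑' m, ‖(x : ℤ × (Fin 3 → ℤ) → EuclideanSpace ℂ (Fin 3)) m‖ₑ ^ 2 ≤ C ^ 2) : ‖x‖ₑ ≤ C := by
  rw [← l2_enorm_sq_eq_tsum] at h
  exact (ENNReal.pow_le_pow_left_iff two_ne_zero).1 h

/-- Real form: `‖x‖ ≤ C` from `∑ₘ ‖x m‖ₑ² ≤ (ofReal C)²`. [folklore] -/
theorem l2_norm_le_of_tsum_le (x : lp (fun _ : ℤ × (Fin 3 → ℤ) => EuclideanSpace ℂ (Fin 3)) 2) {C : ℝ} (hC : 0 ≤ C)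
    (h : ∑' m, ‖(x : ℤ × (Fin 3 → ℤ) → EuclideanSpace ℂ (Fin 3)) m‖ₑ ^ 2 ≤ ENNReal.ofReal C ^ 2) : ‖x‖ ≤ C := by
  have h1 := l2_enorm_le_of_tsum_le x h
  rwa [← ofReal_norm, ENNReal.ofReal_le_ofReal_iff hC] at h1

/-- Evaluation at a frequency is continuous on `ℓ²`. [folklore] -/
theorem l2_continuous_apply (m : ℤ × (Fin 3 → ℤ)) :
    Continuous fun x : lp (fun _ : ℤ × (Fin 3 → ℤ) => EuclideanSpace ℂ (Fin 3)) 2 =>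
      (x : ℤ × (Fin 3 → ℤ) → EuclideanSpace ℂ (Fin 3)) m :=
  (continuous_apply m).comp (lp.uniformContinuous_coe (p := (2 : ℝ≥0∞))).continuous

/-- Coordinates of sums. [folklore] -/
theorem l2_coe_add (x y : lp (fun _ : ℤ × (Fin 3 → ℤ) => EuclideanSpace ℂ (Fin 3)) 2) :
    ((x + y : lp (fun _ : ℤ × (Fin 3 → ℤ) => EuclideanSpace ℂ (Fin 3)) 2) : ℤ × (Fin 3 → ℤ) → EuclideanSpace ℂ (Fin 3)) =
      (x : ℤ × (Fin 3 → ℤ) → EuclideanSpace ℂ (Fin 3)) + (y : ℤ × (Fin 3 → ℤ) → EuclideanSpace ℂ (Fin 3)) := rfl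

/-- Coordinates of real multiples. [folklore] -/
theorem l2_coe_smul (a : ℝ) (x : lp (fun _ : ℤ × (Fin 3 → ℤ) => EuclideanSpace ℂ (Fin 3)) 2) :
    ((a • x : lp (fun _ : ℤ × (Fin 3 → ℤ) => EuclideanSpace ℂ (Fin 3)) 2) : ℤ × (Fin 3 → ℤ) → EuclideanSpace ℂ (Fin 3)) =
      a • (x : ℤ × (Fin 3 → ℤ) → EuclideanSpace ℂ (Fin 3)) := rfl

/-- Coordinates of differences. [folklore] -/
theorem l2_coe_sub (x y : lp (fun _ : ℤ × (Fin 3 → ℤ) => EuclideanSpace ℂ (Fin 3)) 2) :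
    ((x - y : lp (fun _ : ℤ × (Fin 3 → ℤ) => EuclideanSpace ℂ (Fin 3)) 2) : ℤ × (Fin 3 → ℤ) → EuclideanSpace ℂ (Fin 3)) =
      (x : ℤ × (Fin 3 → ℤ) → EuclideanSpace ℂ (Fin 3)) - (y : ℤ × (Fin 3 → ℤ) → EuclideanSpace ℂ (Fin 3)) := rfl

/-- Coordinates of negatives. [folklore] -/
theorem l2_coe_neg (x : lp (fun _ : ℤ × (Fin 3 → ℤ) => EuclideanSpace ℂ (Fin 3)) 2) :
    ((-x : lp (fun _ : ℤ × (Fin 3 → ℤ) => EuclideanSpace ℂ (Fin 3)) 2) : ℤ × (Fin 3 → ℤ) → EuclideanSpace ℂ (Fin 3)) =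
      -(x : ℤ × (Fin 3 → ℤ) → EuclideanSpace ℂ (Fin 3)) := rfl

end L2

/-! ## §B' The state space `W ⊂ ℓ²(𝕃; ℂ³)` -/

section Space

/-- `k · v` is additive in the vector. [folklore] -/
theorem kdot_add (k : Fin 3 → ℤ) (v w : EuclideanSpace ℂ (Fin 3)) :
    (∑ jj : Fin 3, ((k jj : ℤ) : ℂ) * (v + w) jj) =
      (∑ jj : Fin 3, ((k jj : ℤ) : ℂ) * v jj) + (∑ jj : Fin 3, ((k jj : ℤ) : ℂ) * w jj) :=
  SteadyLattice.kdot_add k v w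

/-- `k · v` is `ℂ`-homogeneous in the vector. [folklore] -/
theorem kdot_smul (k : Fin 3 → ℤ) (c : ℂ) (v : EuclideanSpace ℂ (Fin 3)) :
    (∑ jj : Fin 3, ((k jj : ℤ) : ℂ) * (c • v) jj) = c * (∑ jj : Fin 3, ((k jj : ℤ) : ℂ) * v jj) :=
  SteadyLattice.kdot_smul k c v

/-- `(−k) · v = −(k · v)`. [folklore] -/
theorem kdot_neg (k : Fin 3 → ℤ) (v : EuclideanSpace ℂ (Fin 3)) :
    (∑ jj : Fin 3, (((-k) jj : ℤ) : ℂ) * v jj) = -(∑ jj : Fin 3, ((k jj : ℤ) : ℂ) * v jj) := by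
  simp only [Pi.neg_apply, Int.cast_neg, neg_mul, Finset.sum_neg_distrib]

/-- `k · conj v = conj (k · v)`. [folklore] -/
theorem kdot_conjVec (k : Fin 3 → ℤ) (v : EuclideanSpace ℂ (Fin 3)) :
    (∑ jj : Fin 3, ((k jj : ℤ) : ℂ) * (conjVec v) jj) = conj (∑ jj : Fin 3, ((k jj : ℤ) : ℂ) * v jj) := by
  rw [map_sum]
  refine Finset.sum_congr rfl fun j _ => ?_
  rw [conjVec_apply, map_mul, map_intCast]

/-- **The state space exists**: the square-summable families on `ℤ × ℤ³` vanishing on the zero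
spatial modes, transversal and conjugate symmetric form a closed real subspace `W` of
`ℓ²(ℤ × ℤ³; ℂ³)` — the common carrier of the maximal-regularity class `X` and of `Y = L²`
(real, mean-zero, divergence-free fields on `S¹ × T³`, on the Fourier side). [folklore] -/
theorem exists_space : ∃ W : Submodule ℝ (lp (fun _ : ℤ × (Fin 3 → ℤ) => EuclideanSpace ℂ (Fin 3)) 2),
    (∀ x : lp (fun _ : ℤ × (Fin 3 → ℤ) => EuclideanSpace ℂ (Fin 3)) 2, x ∈ W ↔
      (∀ n : ℤ, (x : ℤ × (Fin 3 → ℤ) → EuclideanSpace ℂ (Fin 3)) (n, 0) = 0) ∧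
      (∀ mm : ℤ × (Fin 3 → ℤ), (∑ jj : Fin 3, ((mm.2 jj : ℤ) : ℂ) *
        ((x : ℤ × (Fin 3 → ℤ) → EuclideanSpace ℂ (Fin 3)) mm) jj) = 0) ∧
      (∀ mm : ℤ × (Fin 3 → ℤ), (x : ℤ × (Fin 3 → ℤ) → EuclideanSpace ℂ (Fin 3)) (-mm) =
        conjVec ((x : ℤ × (Fin 3 → ℤ) → EuclideanSpace ℂ (Fin 3)) mm))) ∧
    IsClosed (W : Set (lp (fun _ : ℤ × (Fin 3 → ℤ) => EuclideanSpace ℂ (Fin 3)) 2)) := by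
  set S : Set (lp (fun _ : ℤ × (Fin 3 → ℤ) => EuclideanSpace ℂ (Fin 3)) 2) :=
    {x | (∀ n : ℤ, (x : ℤ × (Fin 3 → ℤ) → EuclideanSpace ℂ (Fin 3)) (n, 0) = 0) ∧
      (∀ mm : ℤ × (Fin 3 → ℤ), (∑ jj : Fin 3, ((mm.2 jj : ℤ) : ℂ) *
        ((x : ℤ × (Fin 3 → ℤ) → EuclideanSpace ℂ (Fin 3)) mm) jj) = 0) ∧
      (∀ mm : ℤ × (Fin 3 → ℤ), (x : ℤ × (Fin 3 → ℤ) → EuclideanSpace ℂ (Fin 3)) (-mm) =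
        conjVec ((x : ℤ × (Fin 3 → ℤ) → EuclideanSpace ℂ (Fin 3)) mm))} with hS
  refine ⟨{ carrier := S, add_mem' := ?_, zero_mem' := ?_, smul_mem' := ?_ }, fun x => Iff.rfl, ?_⟩
  · rintro x y ⟨hx0, hxt, hxc⟩ ⟨hy0, hyt, hyc⟩
    refine ⟨fun n => ?_, fun mm => ?_, fun mm => ?_⟩
    · change (x : ℤ × (Fin 3 → ℤ) → EuclideanSpace ℂ (Fin 3)) (n, 0) +
        (y : ℤ × (Fin 3 → ℤ) → EuclideanSpace ℂ (Fin 3)) (n, 0) = 0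
      rw [hx0, hy0, add_zero]
    · change (∑ jj : Fin 3, ((mm.2 jj : ℤ) : ℂ) * ((x : ℤ × (Fin 3 → ℤ) → EuclideanSpace ℂ (Fin 3)) mm +
        (y : ℤ × (Fin 3 → ℤ) → EuclideanSpace ℂ (Fin 3)) mm) jj) = 0
      rw [kdot_add, hxt mm, hyt mm, add_zero]
    · change (x : ℤ × (Fin 3 → ℤ) → EuclideanSpace ℂ (Fin 3)) (-mm) + (y : ℤ × (Fin 3 → ℤ) → EuclideanSpace ℂ (Fin 3)) (-mm) =
        conjVec ((x : ℤ × (Fin 3 → ℤ) → EuclideanSpace ℂ (Fin 3)) mm + (y : ℤ × (Fin 3 → ℤ) → EuclideanSpace ℂ (Fin 3)) mm)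
      rw [hxc, hyc, conjVec_add]
  · refine ⟨fun n => rfl, fun mm => by simp, fun mm => ?_⟩
    change (0 : EuclideanSpace ℂ (Fin 3)) = conjVec 0
    rw [conjVec_zero]
  · rintro a x ⟨hx0, hxt, hxc⟩
    refine ⟨fun n => ?_, fun mm => ?_, fun mm => ?_⟩
    · change a • (x : ℤ × (Fin 3 → ℤ) → EuclideanSpace ℂ (Fin 3)) (n, 0) = 0
      rw [hx0, smul_zero]
    · change (∑ jj : Fin 3, ((mm.2 jj : ℤ) : ℂ) * (a • (x : ℤ × (Fin 3 → ℤ) → EuclideanSpace ℂ (Fin 3)) mm) jj) = 0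
      rw [← Complex.coe_smul, kdot_smul, hxt mm, mul_zero]
    · change a • (x : ℤ × (Fin 3 → ℤ) → EuclideanSpace ℂ (Fin 3)) (-mm) =
        conjVec (a • (x : ℤ × (Fin 3 → ℤ) → EuclideanSpace ℂ (Fin 3)) mm)
      rw [hxc, ← Complex.coe_smul, ← Complex.coe_smul, conjVec_smul, Complex.conj_ofReal]
  · have h1 : IsClosed {x : lp (fun _ : ℤ × (Fin 3 → ℤ) => EuclideanSpace ℂ (Fin 3)) 2 |
        ∀ n : ℤ, (x : ℤ × (Fin 3 → ℤ) → EuclideanSpace ℂ (Fin 3)) (n, 0) = 0} := by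
      rw [Set.setOf_forall]
      exact isClosed_iInter fun n => isClosed_eq (l2_continuous_apply (n, 0)) continuous_const
    have h2 : IsClosed {x : lp (fun _ : ℤ × (Fin 3 → ℤ) => EuclideanSpace ℂ (Fin 3)) 2 |
        ∀ mm : ℤ × (Fin 3 → ℤ), (∑ jj : Fin 3, ((mm.2 jj : ℤ) : ℂ) *
          ((x : ℤ × (Fin 3 → ℤ) → EuclideanSpace ℂ (Fin 3)) mm) jj) = 0} := by
      rw [Set.setOf_forall]
      exact isClosed_iInter fun mm =>
        isClosed_eq ((SteadyLattice.continuous_kdot mm.2).comp (l2_continuous_apply mm)) continuous_const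
    have h3 : IsClosed {x : lp (fun _ : ℤ × (Fin 3 → ℤ) => EuclideanSpace ℂ (Fin 3)) 2 |
        ∀ mm : ℤ × (Fin 3 → ℤ), (x : ℤ × (Fin 3 → ℤ) → EuclideanSpace ℂ (Fin 3)) (-mm) =
          conjVec ((x : ℤ × (Fin 3 → ℤ) → EuclideanSpace ℂ (Fin 3)) mm)} := by
      rw [Set.setOf_forall]
      exact isClosed_iInter fun mm => isClosed_eq (l2_continuous_apply (-mm))
        (conjVecL.continuous.comp (l2_continuous_apply mm))
    have e : S = {x : lp (fun _ : ℤ × (Fin 3 → ℤ) => EuclideanSpace ℂ (Fin 3)) 2 |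
        ∀ n : ℤ, (x : ℤ × (Fin 3 → ℤ) → EuclideanSpace ℂ (Fin 3)) (n, 0) = 0} ∩
        ({x : lp (fun _ : ℤ × (Fin 3 → ℤ) => EuclideanSpace ℂ (Fin 3)) 2 |
          ∀ mm : ℤ × (Fin 3 → ℤ), (∑ jj : Fin 3, ((mm.2 jj : ℤ) : ℂ) *
            ((x : ℤ × (Fin 3 → ℤ) → EuclideanSpace ℂ (Fin 3)) mm) jj) = 0} ∩
        {x : lp (fun _ : ℤ × (Fin 3 → ℤ) => EuclideanSpace ℂ (Fin 3)) 2 |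
          ∀ mm : ℤ × (Fin 3 → ℤ), (x : ℤ × (Fin 3 → ℤ) → EuclideanSpace ℂ (Fin 3)) (-mm) =
            conjVec ((x : ℤ × (Fin 3 → ℤ) → EuclideanSpace ℂ (Fin 3)) mm)}) := by
      ext x; simp only [hS, Set.mem_setOf_eq, Set.mem_inter_iff]
    change IsClosed S
    rw [e]
    exact h1.inter (h2.inter h3)

variable {W : Submodule ℝ (lp (fun _ : ℤ × (Fin 3 → ℤ) => EuclideanSpace ℂ (Fin 3)) 2)}

/-- Coordinates of a sum in `W`. [folklore] -/
theorem coeW_add (x y : W) :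
    (((x + y : W) : lp (fun _ : ℤ × (Fin 3 → ℤ) => EuclideanSpace ℂ (Fin 3)) 2) : ℤ × (Fin 3 → ℤ) → EuclideanSpace ℂ (Fin 3)) =
      ((x : lp (fun _ : ℤ × (Fin 3 → ℤ) => EuclideanSpace ℂ (Fin 3)) 2) : ℤ × (Fin 3 → ℤ) → EuclideanSpace ℂ (Fin 3)) +
      ((y : lp (fun _ : ℤ × (Fin 3 → ℤ) => EuclideanSpace ℂ (Fin 3)) 2) : ℤ × (Fin 3 → ℤ) → EuclideanSpace ℂ (Fin 3)) := rfl

/-- Coordinates of a difference in `W`. [folklore] -/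
theorem coeW_sub (x y : W) :
    (((x - y : W) : lp (fun _ : ℤ × (Fin 3 → ℤ) => EuclideanSpace ℂ (Fin 3)) 2) : ℤ × (Fin 3 → ℤ) → EuclideanSpace ℂ (Fin 3)) =
      ((x : lp (fun _ : ℤ × (Fin 3 → ℤ) => EuclideanSpace ℂ (Fin 3)) 2) : ℤ × (Fin 3 → ℤ) → EuclideanSpace ℂ (Fin 3)) -
      ((y : lp (fun _ : ℤ × (Fin 3 → ℤ) => EuclideanSpace ℂ (Fin 3)) 2) : ℤ × (Fin 3 → ℤ) → EuclideanSpace ℂ (Fin 3)) := rfl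

/-- Coordinates of a real multiple in `W`. [folklore] -/
theorem coeW_smul (a : ℝ) (x : W) :
    (((a • x : W) : lp (fun _ : ℤ × (Fin 3 → ℤ) => EuclideanSpace ℂ (Fin 3)) 2) : ℤ × (Fin 3 → ℤ) → EuclideanSpace ℂ (Fin 3)) =
      a • ((x : lp (fun _ : ℤ × (Fin 3 → ℤ) => EuclideanSpace ℂ (Fin 3)) 2) : ℤ × (Fin 3 → ℤ) → EuclideanSpace ℂ (Fin 3)) := rfl

/-- Coordinates of zero in `W`. [folklore] -/
theorem coeW_zero :
    (((0 : W) : lp (fun _ : ℤ × (Fin 3 → ℤ) => EuclideanSpace ℂ (Fin 3)) 2) : ℤ × (Fin 3 → ℤ) → EuclideanSpace ℂ (Fin 3)) = 0 := rfl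

/-- The norm of `x ∈ W` is its `ℓ²` norm. [folklore] -/
theorem norm_coeW (x : W) : ‖(x : lp (fun _ : ℤ × (Fin 3 → ℤ) => EuclideanSpace ℂ (Fin 3)) 2)‖ = ‖x‖ := rfl

/-- The extended norm of a difference in `W` is that of the `ℓ²` difference. [folklore] -/
theorem enorm_coeW_sub (x y : W) :
    ‖((x - y : W) : lp (fun _ : ℤ × (Fin 3 → ℤ) => EuclideanSpace ℂ (Fin 3)) 2)‖ₑ = ‖x - y‖ₑ := rfl

/-- Two elements of `W` with the same coordinates are equal. [folklore] -/
theorem W_ext {x y : W}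
    (h : ∀ m, ((x : lp (fun _ : ℤ × (Fin 3 → ℤ) => EuclideanSpace ℂ (Fin 3)) 2) : ℤ × (Fin 3 → ℤ) → EuclideanSpace ℂ (Fin 3)) m =
      ((y : lp (fun _ : ℤ × (Fin 3 → ℤ) => EuclideanSpace ℂ (Fin 3)) 2) : ℤ × (Fin 3 → ℤ) → EuclideanSpace ℂ (Fin 3)) m) :
    x = y :=
  Subtype.ext (lp.ext (funext h))

variable (hW : ∀ x : lp (fun _ : ℤ × (Fin 3 → ℤ) => EuclideanSpace ℂ (Fin 3)) 2, x ∈ W ↔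
      (∀ n : ℤ, (x : ℤ × (Fin 3 → ℤ) → EuclideanSpace ℂ (Fin 3)) (n, 0) = 0) ∧
      (∀ mm : ℤ × (Fin 3 → ℤ), (∑ jj : Fin 3, ((mm.2 jj : ℤ) : ℂ) *
        ((x : ℤ × (Fin 3 → ℤ) → EuclideanSpace ℂ (Fin 3)) mm) jj) = 0) ∧
      (∀ mm : ℤ × (Fin 3 → ℤ), (x : ℤ × (Fin 3 → ℤ) → EuclideanSpace ℂ (Fin 3)) (-mm) =
        conjVec ((x : ℤ × (Fin 3 → ℤ) → EuclideanSpace ℂ (Fin 3)) mm)))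
include hW

/-- Zero spatial modes of an element of `W` vanish. [folklore] -/
theorem W_zero (x : W) (n : ℤ) :
    ((x : lp (fun _ : ℤ × (Fin 3 → ℤ) => EuclideanSpace ℂ (Fin 3)) 2) : ℤ × (Fin 3 → ℤ) → EuclideanSpace ℂ (Fin 3)) (n, 0) = 0 :=
  ((hW x).1 x.2).1 n

/-- Coordinates of an element of `W` vanish wherever the spatial frequency does. [folklore] -/
theorem W_zero' (x : W) {m : ℤ × (Fin 3 → ℤ)} (hm : m.2 = 0) :
    ((x : lp (fun _ : ℤ × (Fin 3 → ℤ) => EuclideanSpace ℂ (Fin 3)) 2) : ℤ × (Fin 3 → ℤ) → EuclideanSpace ℂ (Fin 3)) m = 0 := by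
  have : m = (m.1, 0) := Prod.ext rfl hm
  rw [this]
  exact W_zero hW x m.1

/-- Transversality of an element of `W`. [folklore] -/
theorem W_trans (x : W) (m : ℤ × (Fin 3 → ℤ)) :
    (∑ jj : Fin 3, ((m.2 jj : ℤ) : ℂ) *
      (((x : lp (fun _ : ℤ × (Fin 3 → ℤ) => EuclideanSpace ℂ (Fin 3)) 2) : ℤ × (Fin 3 → ℤ) → EuclideanSpace ℂ (Fin 3)) m) jj) = 0 :=
  ((hW x).1 x.2).2.1 m

/-- Conjugate symmetry of an element of `W`. [folklore] -/
theorem W_conj (x : W) (m : ℤ × (Fin 3 → ℤ)) :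
    ((x : lp (fun _ : ℤ × (Fin 3 → ℤ) => EuclideanSpace ℂ (Fin 3)) 2) : ℤ × (Fin 3 → ℤ) → EuclideanSpace ℂ (Fin 3)) (-m) =
      conjVec (((x : lp (fun _ : ℤ × (Fin 3 → ℤ) => EuclideanSpace ℂ (Fin 3)) 2) : ℤ × (Fin 3 → ℤ) → EuclideanSpace ℂ (Fin 3)) m) :=
  ((hW x).1 x.2).2.2 m

omit hW in
/-- `W` is complete when closed. [folklore] -/
theorem completeSpace_W (hWc : IsClosed (W : Set (lp (fun _ : ℤ × (Fin 3 → ℤ) => EuclideanSpace ℂ (Fin 3)) 2))) :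
    CompleteSpace W := hWc.completeSpace_coe

end Space

/-! ## §C' Diagonal (Fourier-multiplier) operators on `W` -/

section Diagonal

variable {W : Submodule ℝ (lp (fun _ : ℤ × (Fin 3 → ℤ) => EuclideanSpace ℂ (Fin 3)) 2)}
variable (hW : ∀ x : lp (fun _ : ℤ × (Fin 3 → ℤ) => EuclideanSpace ℂ (Fin 3)) 2, x ∈ W ↔
      (∀ n : ℤ, (x : ℤ × (Fin 3 → ℤ) → EuclideanSpace ℂ (Fin 3)) (n, 0) = 0) ∧
      (∀ mm : ℤ × (Fin 3 → ℤ), (∑ jj : Fin 3, ((mm.2 jj : ℤ) : ℂ) *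
        ((x : ℤ × (Fin 3 → ℤ) → EuclideanSpace ℂ (Fin 3)) mm) jj) = 0) ∧
      (∀ mm : ℤ × (Fin 3 → ℤ), (x : ℤ × (Fin 3 → ℤ) → EuclideanSpace ℂ (Fin 3)) (-mm) =
        conjVec ((x : ℤ × (Fin 3 → ℤ) → EuclideanSpace ℂ (Fin 3)) mm)))

/-- A bounded multiplier preserves square summability: `∑ ‖d m • f m‖² < ∞`. [folklore] -/
theorem memℓp_two_mul {d : ℤ × (Fin 3 → ℤ) → ℂ} {M : ℝ} (hd : ∀ m, ‖d m‖ ≤ M)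
    (x : lp (fun _ : ℤ × (Fin 3 → ℤ) => EuclideanSpace ℂ (Fin 3)) 2) :
    Memℓp (fun m => d m • (x : ℤ × (Fin 3 → ℤ) → EuclideanSpace ℂ (Fin 3)) m) 2 := by
  have hle : ∑' m, ‖d m • (x : ℤ × (Fin 3 → ℤ) → EuclideanSpace ℂ (Fin 3)) m‖ₑ ^ 2 ≤
      (ENNReal.ofReal M) ^ 2 * ∑' m, ‖(x : ℤ × (Fin 3 → ℤ) → EuclideanSpace ℂ (Fin 3)) m‖ₑ ^ 2 := by
    rw [← ENNReal.tsum_mul_left]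
    refine ENNReal.tsum_le_tsum fun m => ?_
    rw [enorm_smul, mul_pow]
    gcongr
    rw [← ofReal_norm]
    exact ENNReal.ofReal_le_ofReal (hd m)
  exact memℓp_two_of_tsum_ne_top (ne_top_of_le_ne_top
    (ENNReal.mul_ne_top (ENNReal.pow_ne_top ENNReal.ofReal_ne_top) (l2_tsum_enorm_sq_ne_top x)) hle)

include hW in
/-- **Bounded conjugate-symmetric multipliers act on `W`**: for `d : ℤ × ℤ³ → ℂ` with `‖d‖ ≤ M`
and `d(−m) = conj d(m)` there is `D : W →L[ℝ] W` with `(D x)(m) = d(m) x(m)` and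
`‖D x‖ ≤ M ‖x‖`. [folklore] -/
theorem exists_diag {d : ℤ × (Fin 3 → ℤ) → ℂ} {M : ℝ} (hd : ∀ m, ‖d m‖ ≤ M) (hdc : ∀ m, d (-m) = conj (d m)) :
    ∃ D : W →L[ℝ] W, (∀ (x : W) (m : ℤ × (Fin 3 → ℤ)),
      (((D x : W) : lp (fun _ : ℤ × (Fin 3 → ℤ) => EuclideanSpace ℂ (Fin 3)) 2) : ℤ × (Fin 3 → ℤ) → EuclideanSpace ℂ (Fin 3)) m =
        d m • (((x : lp (fun _ : ℤ × (Fin 3 → ℤ) => EuclideanSpace ℂ (Fin 3)) 2) : ℤ × (Fin 3 → ℤ) → EuclideanSpace ℂ (Fin 3)) m)) ∧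
      ∀ x : W, ‖D x‖ ≤ M * ‖x‖ := by
  have hM : 0 ≤ M := (norm_nonneg _).trans (hd 0)
  -- the raw map into `ℓ²`
  set g : W → lp (fun _ : ℤ × (Fin 3 → ℤ) => EuclideanSpace ℂ (Fin 3)) 2 := fun x =>
    ⟨fun m => d m • (((x : lp (fun _ : ℤ × (Fin 3 → ℤ) => EuclideanSpace ℂ (Fin 3)) 2) : ℤ × (Fin 3 → ℤ) → EuclideanSpace ℂ (Fin 3)) m),
      memℓp_two_mul hd _⟩ with hg
  have hgcoe : ∀ (x : W) (m : ℤ × (Fin 3 → ℤ)), (g x : ℤ × (Fin 3 → ℤ) → EuclideanSpace ℂ (Fin 3)) m =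
      d m • (((x : lp (fun _ : ℤ × (Fin 3 → ℤ) => EuclideanSpace ℂ (Fin 3)) 2) : ℤ × (Fin 3 → ℤ) → EuclideanSpace ℂ (Fin 3)) m) :=
    fun x m => rfl
  have hgW : ∀ x : W, g x ∈ W := by
    intro x
    refine (hW _).2 ⟨fun n => ?_, fun mm => ?_, fun mm => ?_⟩
    · rw [hgcoe, W_zero hW x n, smul_zero]
    · rw [hgcoe, kdot_smul, W_trans hW x mm, mul_zero]
    · rw [hgcoe, hgcoe, W_conj hW x mm, hdc mm, conjVec_smul]
  have hnorm : ∀ x : W, ‖g x‖ ≤ M * ‖x‖ := by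
    intro x
    refine l2_norm_le_of_tsum_le _ (by positivity) ?_
    rw [ENNReal.ofReal_mul hM, ← norm_coeW, ofReal_norm, mul_pow, l2_enorm_sq_eq_tsum, ← ENNReal.tsum_mul_left]
    refine ENNReal.tsum_le_tsum fun m => ?_
    rw [hgcoe, enorm_smul, mul_pow]
    gcongr
    rw [← ofReal_norm]
    exact ENNReal.ofReal_le_ofReal (hd m)
  set Dl : W →ₗ[ℝ] W :=
    { toFun := fun x => ⟨g x, hgW x⟩
      map_add' := fun x y => by
        refine Subtype.ext (lp.ext (funext fun m => ?_))
        change (g (x + y) : ℤ × (Fin 3 → ℤ) → EuclideanSpace ℂ (Fin 3)) m =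
          (g x : ℤ × (Fin 3 → ℤ) → EuclideanSpace ℂ (Fin 3)) m + (g y : ℤ × (Fin 3 → ℤ) → EuclideanSpace ℂ (Fin 3)) m
        rw [hgcoe, hgcoe, hgcoe, coeW_add, Pi.add_apply, smul_add]
      map_smul' := fun a x => by
        refine Subtype.ext (lp.ext (funext fun m => ?_))
        change (g (a • x) : ℤ × (Fin 3 → ℤ) → EuclideanSpace ℂ (Fin 3)) m =
          (a • (g x : ℤ × (Fin 3 → ℤ) → EuclideanSpace ℂ (Fin 3))) m
        rw [hgcoe, Pi.smul_apply, hgcoe, coeW_smul, Pi.smul_apply, smul_comm] } with hDl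
  refine ⟨Dl.mkContinuous M fun x => hnorm x, fun x m => rfl, fun x => ?_⟩
  exact hnorm x

/-- The inverse multiplier `d'(m) = d(m)⁻¹` off `k = 0` (and `0` on `k = 0`) is bounded by `c⁻¹`
when `c ≤ ‖d‖` off `k = 0`, `c > 0`. [folklore] -/
theorem norm_invMul_le {d : ℤ × (Fin 3 → ℤ) → ℂ} {c : ℝ} (hc : 0 < c) (hdl : ∀ m : ℤ × (Fin 3 → ℤ), m.2 ≠ 0 → c ≤ ‖d m‖)
    (m : ℤ × (Fin 3 → ℤ)) : ‖(if m.2 = 0 then (0 : ℂ) else (d m)⁻¹)‖ ≤ c⁻¹ := by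
  split_ifs with h
  · simp [inv_nonneg.2 hc.le]
  · rw [norm_inv]
    exact inv_anti₀ hc (hdl m h)

/-- The inverse multiplier is conjugate symmetric when `d` is. [folklore] -/
theorem invMul_neg {d : ℤ × (Fin 3 → ℤ) → ℂ} (hdc : ∀ m, d (-m) = conj (d m)) (m : ℤ × (Fin 3 → ℤ)) :
    (if (-m).2 = 0 then (0 : ℂ) else (d (-m))⁻¹) = conj (if m.2 = 0 then (0 : ℂ) else (d m)⁻¹) := by
  have h : (-m).2 = 0 ↔ m.2 = 0 := by simp [Prod.snd_neg, neg_eq_zero]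
  by_cases hm : m.2 = 0
  · rw [if_pos (h.2 hm), if_pos hm, map_zero]
  · rw [if_neg (fun h' => hm (h.1 h')), if_neg hm, hdc, map_inv₀]

include hW in
/-- **Multipliers bounded below off the zero spatial modes are isomorphisms of `W`**: if moreover
`0 < c ≤ ‖d(m)‖` for `k ≠ 0`, there is `L : W ≃L[ℝ] W` acting by `d` with inverse acting by `d⁻¹`,
`‖L x‖ ≤ M‖x‖`, `‖L⁻¹ y‖ ≤ c⁻¹‖y‖` (elements of `W` vanish on `k = 0`). [folklore] -/
theorem exists_diagEquiv {d : ℤ × (Fin 3 → ℤ) → ℂ} {M c : ℝ} (hd : ∀ m, ‖d m‖ ≤ M) (hdc : ∀ m, d (-m) = conj (d m))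
    (hc : 0 < c) (hdl : ∀ m : ℤ × (Fin 3 → ℤ), m.2 ≠ 0 → c ≤ ‖d m‖) :
    ∃ L : W ≃L[ℝ] W, (∀ (x : W) (m : ℤ × (Fin 3 → ℤ)),
      (((L x : W) : lp (fun _ : ℤ × (Fin 3 → ℤ) => EuclideanSpace ℂ (Fin 3)) 2) : ℤ × (Fin 3 → ℤ) → EuclideanSpace ℂ (Fin 3)) m =
        d m • (((x : lp (fun _ : ℤ × (Fin 3 → ℤ) => EuclideanSpace ℂ (Fin 3)) 2) : ℤ × (Fin 3 → ℤ) → EuclideanSpace ℂ (Fin 3)) m)) ∧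
      (∀ (y : W) (m : ℤ × (Fin 3 → ℤ)), m.2 ≠ 0 →
        (((L.symm y : W) : lp (fun _ : ℤ × (Fin 3 → ℤ) => EuclideanSpace ℂ (Fin 3)) 2) : ℤ × (Fin 3 → ℤ) → EuclideanSpace ℂ (Fin 3)) m =
          (d m)⁻¹ • (((y : lp (fun _ : ℤ × (Fin 3 → ℤ) => EuclideanSpace ℂ (Fin 3)) 2) : ℤ × (Fin 3 → ℤ) → EuclideanSpace ℂ (Fin 3)) m)) ∧
      (∀ x : W, ‖L x‖ ≤ M * ‖x‖) ∧ (∀ y : W, ‖L.symm y‖ ≤ c⁻¹ * ‖y‖) := by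
  obtain ⟨D, hD, hDn⟩ := exists_diag hW hd hdc
  obtain ⟨D', hD', hD'n⟩ := exists_diag hW (norm_invMul_le hc hdl) (invMul_neg hdc)
  have h1 : ∀ x : W, D' (D x) = x := by
    intro x
    refine W_ext fun m => ?_
    rw [hD', hD]
    by_cases hm : m.2 = 0
    · rw [W_zero' hW x hm, smul_zero, smul_zero]
    · rw [if_neg hm, smul_smul, inv_mul_cancel₀ (fun h0 => ?_), one_smul]
      have := hdl m hm
      rw [h0, norm_zero] at this
      exact absurd this (not_le.2 hc)
  have h2 : ∀ y : W, D (D' y) = y := by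
    intro y
    refine W_ext fun m => ?_
    rw [hD, hD']
    by_cases hm : m.2 = 0
    · rw [W_zero' hW y hm, smul_zero, smul_zero]
    · rw [if_neg hm, smul_smul, mul_inv_cancel₀ (fun h0 => ?_), one_smul]
      have := hdl m hm
      rw [h0, norm_zero] at this
      exact absurd this (not_le.2 hc)
  refine ⟨ContinuousLinearEquiv.equivOfInverse D D' h1 h2, fun x m => hD x m, fun y m hm => ?_, fun x => hDn x,
    fun y => hD'n y⟩
  change (((D' y : W) : lp (fun _ : ℤ × (Fin 3 → ℤ) => EuclideanSpace ℂ (Fin 3)) 2) : ℤ × (Fin 3 → ℤ) → EuclideanSpace ℂ (Fin 3)) m = _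
  rw [hD', if_neg hm]

/-! ### The symbols of `∂ₛ`, `−Δ`, the drift, and of `L_ω = ω∂ₛ − νΔ + m₀·∇` -/

/-- The symbol `2πin/Λ(n,k)` of `∂ₛ` between the weighted spaces is bounded by `2π`. [folklore] -/
theorem norm_dsSym_le (m : ℤ × (Fin 3 → ℤ)) :
    ‖(2 * Real.pi * Complex.I * (m.1 : ℂ) * (((Λ m)⁻¹ : ℝ) : ℂ))‖ ≤ 2 * Real.pi := by
  have hn : |((m.1 : ℤ) : ℝ)| ≤ Λ m := abs_le_wt m
  have h0 : 0 ≤ Λ m := wt_nonneg m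
  have e : ‖(2 * Real.pi * Complex.I * (m.1 : ℂ) * (((Λ m)⁻¹ : ℝ) : ℂ))‖ = 2 * Real.pi * |((m.1 : ℤ) : ℝ)| * (Λ m)⁻¹ := by
    rw [norm_mul, Complex.norm_real, Real.norm_of_nonneg (inv_nonneg.2 h0), norm_mul, Complex.norm_intCast]
    congr 2
    simp [abs_of_pos Real.pi_pos]
  rw [e]
  by_cases hz : Λ m = 0
  · rw [hz, inv_zero, mul_zero]
    positivity
  · have hpos : 0 < Λ m := lt_of_le_of_ne h0 (Ne.symm hz)
    rw [mul_assoc]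
    refine mul_le_of_le_one_right (by positivity) ?_
    rw [mul_inv_le_iff₀ hpos, one_mul]
    exact hn

/-- The symbol of `∂ₛ` is conjugate symmetric. [folklore] -/
theorem dsSym_neg (m : ℤ × (Fin 3 → ℤ)) :
    (2 * Real.pi * Complex.I * ((-m).1 : ℂ) * (((Λ (-m))⁻¹ : ℝ) : ℂ)) =
      conj (2 * Real.pi * Complex.I * (m.1 : ℂ) * (((Λ m)⁻¹ : ℝ) : ℂ)) := by
  rw [wt_neg]
  simp only [Prod.fst_neg, Int.cast_neg, map_mul, map_ofNat, Complex.conj_ofReal, Complex.conj_I, map_intCast]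
  ring

/-- The symbol `4π²|k|²/Λ(n,k)` of `−Δ` between the weighted spaces is bounded by `4π²`. [folklore] -/
theorem norm_lapSym_le (m : ℤ × (Fin 3 → ℤ)) :
    ‖((4 * Real.pi ^ 2 * freqNormSq m.2 * (Λ m)⁻¹ : ℝ) : ℂ)‖ ≤ 4 * Real.pi ^ 2 := by
  have hk : freqNormSq m.2 ≤ Λ m := freqNormSq_le_wt m
  have h0 : 0 ≤ Λ m := wt_nonneg m
  rw [Complex.norm_real, Real.norm_of_nonneg (by
    exact mul_nonneg (mul_nonneg (by positivity) (freqNormSq_nonneg _)) (inv_nonneg.2 h0))]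
  by_cases hz : Λ m = 0
  · rw [hz, inv_zero, mul_zero]; positivity
  · have hpos : 0 < Λ m := lt_of_le_of_ne h0 (Ne.symm hz)
    rw [mul_assoc]
    refine mul_le_of_le_one_right (by positivity) ?_
    rw [mul_inv_le_iff₀ hpos, one_mul]
    exact hk

/-- The symbol of `−Δ` is conjugate symmetric (real and even). [folklore] -/
theorem lapSym_neg (m : ℤ × (Fin 3 → ℤ)) :
    ((4 * Real.pi ^ 2 * freqNormSq (-m).2 * (Λ (-m))⁻¹ : ℝ) : ℂ) =
      conj ((4 * Real.pi ^ 2 * freqNormSq m.2 * (Λ m)⁻¹ : ℝ) : ℂ) := by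
  rw [wt_neg, Prod.snd_neg, freqNormSq_neg, Complex.conj_ofReal]

/-- `|m₀ · k| ≤ 3 ‖m₀‖ ⟨k⟩` for a real vector `m₀`. [folklore] -/
theorem norm_mdot_le (m₀ : EuclideanSpace ℝ (Fin 3)) (k : Fin 3 → ℤ) :
    ‖(∑ jj : Fin 3, ((m₀ jj : ℝ) : ℂ) * ((k jj : ℤ) : ℂ))‖ ≤ 3 * ‖m₀‖ * sobolevWeight 1 k := by
  calc ‖(∑ jj : Fin 3, ((m₀ jj : ℝ) : ℂ) * ((k jj : ℤ) : ℂ))‖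
      ≤ ∑ jj : Fin 3, ‖((m₀ jj : ℝ) : ℂ) * ((k jj : ℤ) : ℂ)‖ := norm_sum_le _ _
    _ ≤ ∑ _jj : Fin 3, ‖m₀‖ * sobolevWeight 1 k := Finset.sum_le_sum fun j _ => by
        rw [norm_mul, Complex.norm_real, Complex.norm_intCast]
        refine mul_le_mul ?_ (SteadyLattice.abs_apply_le_weight k j) (abs_nonneg _) (norm_nonneg _)
        exact (Real.norm_eq_abs _).symm.le.trans (PiLp.norm_apply_le m₀ j)
    _ = 3 * ‖m₀‖ * sobolevWeight 1 k := by simp [Finset.sum_const, Finset.card_univ]; ring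

/-- The drift symbol `2πi(m₀·k)/Λ(n,k)` is bounded by `12π‖m₀‖` (using `⟨k⟩ ≤ 2|k|² ≤ 2Λ` off
`k = 0`). [folklore] -/
theorem norm_driftSym_le (m₀ : EuclideanSpace ℝ (Fin 3)) (m : ℤ × (Fin 3 → ℤ)) :
    ‖(2 * Real.pi * Complex.I * (∑ jj : Fin 3, ((m₀ jj : ℝ) : ℂ) * ((m.2 jj : ℤ) : ℂ)) * (((Λ m)⁻¹ : ℝ) : ℂ))‖ ≤
      12 * Real.pi * ‖m₀‖ := by
  have h0 : 0 ≤ Λ m := wt_nonneg m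
  by_cases hk : m.2 = 0
  · have : (∑ jj : Fin 3, ((m₀ jj : ℝ) : ℂ) * ((m.2 jj : ℤ) : ℂ)) = 0 := by simp [hk]
    rw [this, mul_zero, zero_mul, norm_zero]
    positivity
  · have hpos : 0 < Λ m := wt_pos hk
    have hw : sobolevWeight 1 m.2 ≤ 2 * Λ m :=
      (SteadyLattice.sobolevWeight_one_le hk).trans (by linarith [freqNormSq_le_wt m])
    rw [norm_mul, norm_mul, Complex.norm_real, Real.norm_of_nonneg (inv_nonneg.2 h0)]
    have hn : ‖(2 * Real.pi * Complex.I : ℂ)‖ = 2 * Real.pi := by simp [abs_of_pos Real.pi_pos]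
    rw [hn]
    have h1 := norm_mdot_le m₀ m.2
    calc 2 * Real.pi * ‖(∑ jj : Fin 3, ((m₀ jj : ℝ) : ℂ) * ((m.2 jj : ℤ) : ℂ))‖ * (Λ m)⁻¹
        ≤ 2 * Real.pi * (3 * ‖m₀‖ * (2 * Λ m)) * (Λ m)⁻¹ := by
          gcongr
          exact h1.trans (mul_le_mul_of_nonneg_left hw (by positivity))
      _ = 12 * Real.pi * ‖m₀‖ := by field_simp; ring

/-- The drift symbol is conjugate symmetric. [folklore] -/
theorem driftSym_neg (m₀ : EuclideanSpace ℝ (Fin 3)) (m : ℤ × (Fin 3 → ℤ)) :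
    (2 * Real.pi * Complex.I * (∑ jj : Fin 3, ((m₀ jj : ℝ) : ℂ) * (((-m).2 jj : ℤ) : ℂ)) * (((Λ (-m))⁻¹ : ℝ) : ℂ)) =
      conj (2 * Real.pi * Complex.I * (∑ jj : Fin 3, ((m₀ jj : ℝ) : ℂ) * ((m.2 jj : ℤ) : ℂ)) * (((Λ m)⁻¹ : ℝ) : ℂ)) := by
  rw [wt_neg]
  simp only [Prod.snd_neg, Pi.neg_apply, Int.cast_neg, map_mul, map_ofNat, Complex.conj_ofReal, Complex.conj_I,
    map_sum, map_intCast, mul_neg, Finset.sum_neg_distrib]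
  ring

/-- **Lower bound of the symbol of `L_ω = ω∂ₛ − νΔ + m₀·∇`**: for `ω, ν > 0` there is `c > 0`
with `c Λ(n,k) ≤ |2πiωn + 4π²ν|k|² + 2πi m₀·k|` off `k = 0` (the drift is dominated: either
`|n|` is large against `|k|²`, and the imaginary part wins, or the real part `4π²ν|k|²` does).
This is the invertibility of `ω∂ₛ − νΔ + m₀·∇` from the maximal-regularity class onto `L²`
(Kielhöfer 2012, §I.8, the operator `κ₀ d/dt − A₀`). [folklore] -/
theorem exists_symbol_lower_bound {ω ν : ℝ} (hω : 0 < ω) (hν : 0 < ν) (m₀ : EuclideanSpace ℝ (Fin 3)) :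
    ∃ c : ℝ, 0 < c ∧ ∀ m : ℤ × (Fin 3 → ℤ), m.2 ≠ 0 →
      c * Λ m ≤ ‖(2 * Real.pi * Complex.I * (ω : ℂ) * (m.1 : ℂ) + ((4 * Real.pi ^ 2 * ν * freqNormSq m.2 : ℝ) : ℂ) +
        2 * Real.pi * Complex.I * (∑ jj : Fin 3, ((m₀ jj : ℝ) : ℂ) * ((m.2 jj : ℤ) : ℂ)))‖ := by
  -- constants: `ε` so small that the drift is absorbed by half the viscous real part
  set D : ℝ := 6 * ‖m₀‖ with hD
  have hD0 : 0 ≤ D := by positivity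
  set ε : ℝ := min 1 (Real.pi * ν / (D + 1)) with hε
  have hε0 : 0 < ε := lt_min zero_lt_one (by positivity)
  have hε1 : ε ≤ 1 := min_le_left _ _
  have hεD : ε * D ≤ Real.pi * ν := by
    have h1 : ε ≤ Real.pi * ν / (D + 1) := min_le_right _ _
    calc ε * D ≤ Real.pi * ν / (D + 1) * D := mul_le_mul_of_nonneg_right h1 hD0
      _ ≤ Real.pi * ν / (D + 1) * (D + 1) := by gcongr; linarith
      _ = Real.pi * ν := by field_simp
  refine ⟨min (Real.pi * ω * ε) (Real.pi ^ 2 * ν), lt_min (by positivity) (by positivity), fun m hm => ?_⟩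
  set n : ℝ := ((m.1 : ℤ) : ℝ) with hn
  set a : ℝ := freqNormSq m.2 with ha
  have ha1 : 1 ≤ a := Torus.one_le_freqNormSq hm
  set s : ℝ := ∑ jj : Fin 3, (m₀ jj : ℝ) * ((m.2 jj : ℤ) : ℝ) with hs
  -- the complex number is `(4π²νa) + i (2πωn + 2πs)`
  have hz : (2 * Real.pi * Complex.I * (ω : ℂ) * (m.1 : ℂ) + ((4 * Real.pi ^ 2 * ν * freqNormSq m.2 : ℝ) : ℂ) +
        2 * Real.pi * Complex.I * (∑ jj : Fin 3, ((m₀ jj : ℝ) : ℂ) * ((m.2 jj : ℤ) : ℂ))) =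
      ((4 * Real.pi ^ 2 * ν * a : ℝ) : ℂ) + ((2 * Real.pi * ω * n + 2 * Real.pi * s : ℝ) : ℂ) * Complex.I := by
    simp only [hn, ha, hs]
    push_cast
    ring
  rw [hz]
  -- `|z| ≥ max(|Re z|, |Im z|) ≥ (Re z + |Im z|)/2`
  have hre : 4 * Real.pi ^ 2 * ν * a ≤ ‖((4 * Real.pi ^ 2 * ν * a : ℝ) : ℂ) +
      ((2 * Real.pi * ω * n + 2 * Real.pi * s : ℝ) : ℂ) * Complex.I‖ := by
    have := Complex.abs_re_le_norm (((4 * Real.pi ^ 2 * ν * a : ℝ) : ℂ) +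
      ((2 * Real.pi * ω * n + 2 * Real.pi * s : ℝ) : ℂ) * Complex.I)
    simp only [Complex.add_re, Complex.ofReal_re, Complex.mul_re, Complex.I_re, mul_zero, Complex.ofReal_im,
      Complex.I_im, zero_mul, sub_zero, add_zero] at this
    exact (le_abs_self _).trans this
  have him : |2 * Real.pi * ω * n + 2 * Real.pi * s| ≤ ‖((4 * Real.pi ^ 2 * ν * a : ℝ) : ℂ) +
      ((2 * Real.pi * ω * n + 2 * Real.pi * s : ℝ) : ℂ) * Complex.I‖ := by
    have := Complex.abs_im_le_norm (((4 * Real.pi ^ 2 * ν * a : ℝ) : ℂ) +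
      ((2 * Real.pi * ω * n + 2 * Real.pi * s : ℝ) : ℂ) * Complex.I)
    simp only [Complex.add_im, Complex.ofReal_im, Complex.mul_im, Complex.I_re, mul_zero, Complex.ofReal_re,
      Complex.I_im, mul_one, zero_add, add_zero] at this
    exact this
  -- `|s| ≤ 3‖m₀‖⟨k⟩ ≤ 6‖m₀‖ a = D a`
  have hsD : |s| ≤ D * a := by
    have h1 := norm_mdot_le m₀ m.2
    have h2 : ‖(∑ jj : Fin 3, ((m₀ jj : ℝ) : ℂ) * ((m.2 jj : ℤ) : ℂ))‖ = |s| := by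
      rw [hs, ← Real.norm_eq_abs, ← Complex.norm_real]
      push_cast
      rfl
    rw [h2] at h1
    have h3 : sobolevWeight 1 m.2 ≤ 2 * a := SteadyLattice.sobolevWeight_one_le hm
    calc |s| ≤ 3 * ‖m₀‖ * sobolevWeight 1 m.2 := h1
      _ ≤ 3 * ‖m₀‖ * (2 * a) := mul_le_mul_of_nonneg_left h3 (by positivity)
      _ = D * a := by rw [hD]; ring
  -- `|2πωn + 2πs| ≥ 2πω|n| − 2π|s|`
  have him2 : 2 * Real.pi * ω * |n| - 2 * Real.pi * |s| ≤ |2 * Real.pi * ω * n + 2 * Real.pi * s| := by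
    have h1 : |2 * Real.pi * ω * n| - |2 * Real.pi * s| ≤ |2 * Real.pi * ω * n + 2 * Real.pi * s| :=
      abs_sub_abs_le_abs_add _ _
    have e1 : |2 * Real.pi * ω * n| = 2 * Real.pi * ω * |n| := by
      rw [abs_mul (2 * Real.pi * ω) n, abs_of_pos (by positivity : (0:ℝ) < 2 * Real.pi * ω)]
    have e2 : |2 * Real.pi * s| = 2 * Real.pi * |s| := by
      rw [abs_mul (2 * Real.pi) s, abs_of_pos (by positivity : (0:ℝ) < 2 * Real.pi)]
    rw [e1, e2] at h1
    exact h1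
  set Z : ℝ := ‖((4 * Real.pi ^ 2 * ν * a : ℝ) : ℂ) + ((2 * Real.pi * ω * n + 2 * Real.pi * s : ℝ) : ℂ) * Complex.I‖ with hZ
  have hZ0 : 0 ≤ Z := norm_nonneg _
  -- combine: `Z ≥ ε·|Im| + (1 − ε)·... ` in the form `2 Z ≥ ε (2πω|n| − 2π D a) + 4π²ν a`
  have hkey : ε * (2 * Real.pi * ω * |n|) + 2 * Real.pi ^ 2 * ν * a ≤ 2 * Z := by
    have h1 : ε * (2 * Real.pi * ω * |n| - 2 * Real.pi * |s|) ≤ ε * Z :=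
      mul_le_mul_of_nonneg_left (him2.trans him) hε0.le
    have h2 : ε * Z ≤ Z := mul_le_of_le_one_left hZ0 hε1
    have h3 : ε * (2 * Real.pi * |s|) ≤ 2 * Real.pi ^ 2 * ν * a := by
      calc ε * (2 * Real.pi * |s|) ≤ ε * (2 * Real.pi * (D * a)) := by gcongr
        _ = 2 * Real.pi * (ε * D) * a := by ring
        _ ≤ 2 * Real.pi * (Real.pi * ν) * a := by gcongr
        _ = 2 * Real.pi ^ 2 * ν * a := by ring
    nlinarith
  have hwt : Λ m = |n| + a := rfl
  rw [hwt]
  calc min (Real.pi * ω * ε) (Real.pi ^ 2 * ν) * (|n| + a)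
      = min (Real.pi * ω * ε) (Real.pi ^ 2 * ν) * |n| + min (Real.pi * ω * ε) (Real.pi ^ 2 * ν) * a := by ring
    _ ≤ (Real.pi * ω * ε) * |n| + (Real.pi ^ 2 * ν) * a :=
        add_le_add (mul_le_mul_of_nonneg_right (min_le_left _ _) (abs_nonneg _))
          (mul_le_mul_of_nonneg_right (min_le_right _ _) (by linarith))
    _ ≤ Z := by nlinarith

end Diagonal

/-! ## §D' The bounded bilinear map `B(x, y) = Π N(x/Λ, y/Λ)` on `W` -/

section BilinearMap

variable {W : Submodule ℝ (lp (fun _ : ℤ × (Fin 3 → ℤ) => EuclideanSpace ℂ (Fin 3)) 2)}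
variable (hW : ∀ x : lp (fun _ : ℤ × (Fin 3 → ℤ) => EuclideanSpace ℂ (Fin 3)) 2, x ∈ W ↔
      (∀ n : ℤ, (x : ℤ × (Fin 3 → ℤ) → EuclideanSpace ℂ (Fin 3)) (n, 0) = 0) ∧
      (∀ mm : ℤ × (Fin 3 → ℤ), (∑ jj : Fin 3, ((mm.2 jj : ℤ) : ℂ) *
        ((x : ℤ × (Fin 3 → ℤ) → EuclideanSpace ℂ (Fin 3)) mm) jj) = 0) ∧
      (∀ mm : ℤ × (Fin 3 → ℤ), (x : ℤ × (Fin 3 → ℤ) → EuclideanSpace ℂ (Fin 3)) (-mm) =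
        conjVec ((x : ℤ × (Fin 3 → ℤ) → EuclideanSpace ℂ (Fin 3)) mm)))

/-- `x/Λ` of a sum. [folklore] -/
theorem cw_add (x y : ℤ × (Fin 3 → ℤ) → EuclideanSpace ℂ (Fin 3)) : 𝐜 (x + y) = 𝐜 x + 𝐜 y := by
  funext m
  simp only [Pi.add_apply, smul_add]

/-- `x/Λ` of a real multiple. [folklore] -/
theorem cw_real_smul (a : ℝ) (x : ℤ × (Fin 3 → ℤ) → EuclideanSpace ℂ (Fin 3)) : 𝐜 (a • x) = (a : ℂ) • 𝐜 x := by
  funext m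
  simp only [Pi.smul_apply]
  rw [← Complex.coe_smul, smul_comm]

/-- `x/Λ` is transversal when `x` is. [folklore] -/
theorem cw_transversal {x : ℤ × (Fin 3 → ℤ) → EuclideanSpace ℂ (Fin 3)}
    (hx : ∀ mm : ℤ × (Fin 3 → ℤ), (∑ jj : Fin 3, ((mm.2 jj : ℤ) : ℂ) * (x mm) jj) = 0) (m : ℤ × (Fin 3 → ℤ)) :
    (∑ jj : Fin 3, ((m.2 jj : ℤ) : ℂ) * ((𝐜 x) m) jj) = 0 := by
  change (∑ jj : Fin 3, ((m.2 jj : ℤ) : ℂ) * ((((Λ m)⁻¹ : ℝ) : ℂ) • x m) jj) = 0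
  rw [kdot_smul, hx m, mul_zero]

/-- `x/Λ` is conjugate symmetric when `x` is (the weight is even and real). [folklore] -/
theorem cw_neg {x : ℤ × (Fin 3 → ℤ) → EuclideanSpace ℂ (Fin 3)} (hx : ∀ mm, x (-mm) = conjVec (x mm))
    (m : ℤ × (Fin 3 → ℤ)) : (𝐜 x) (-m) = conjVec ((𝐜 x) m) := by
  change (((Λ (-m))⁻¹ : ℝ) : ℂ) • x (-m) = conjVec ((((Λ m)⁻¹ : ℝ) : ℂ) • x m)
  rw [wt_neg, hx m, conjVec_smul, Complex.conj_ofReal]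

/-- `x/Λ` vanishes on the zero spatial modes when `x` does. [folklore] -/
theorem cw_zero_mode {x : ℤ × (Fin 3 → ℤ) → EuclideanSpace ℂ (Fin 3)} (hx : ∀ n : ℤ, x (n, 0) = 0) (n : ℤ) :
    (𝐜 x) (n, 0) = 0 := by
  change (((Λ ((n, 0) : ℤ × (Fin 3 → ℤ)))⁻¹ : ℝ) : ℂ) • x (n, 0) = 0
  rw [hx n, smul_zero]

/-- `t ≤ (t + 1)²` in `ℝ≥0∞`. [folklore] -/
theorem ennreal_le_add_one_sq (t : ℝ≥0∞) : t ≤ (t + 1) ^ 2 := by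
  calc t ≤ t + 1 := le_self_add
    _ = (t + 1) ^ 1 := (pow_one _).symm
    _ ≤ (t + 1) ^ 2 := pow_le_pow_right₀ (le_add_self) one_le_two

include hW in
/-- **The projected convective symbol is a bounded real-bilinear map on `W`**:
`B(x, y)(n, k) = Π_k N(x/Λ, y/Λ)(n, k)` — the Fourier side of `ℙ((v·∇)w)` as a map
`X × X → Y` from the maximal-regularity class to `L²` (`tsum_enorm_nl_sq_le` for the bound;
`Π_k` kills the zero modes, produces transversal vectors and commutes with conjugation).
Delivered as an existence statement with its defining formula. [folklore] -/
theorem exists_bilinear : ∃ B : W → W → W,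
    (∀ (x y : W) (m : ℤ × (Fin 3 → ℤ)), (𝐰 (B x y)) m = Torus.lerayCoeff m.2 (𝐍[𝐜 (𝐰 x), 𝐜 (𝐰 y)] m)) ∧
    IsBoundedBilinearMap ℝ (fun p : W × W => B p.1 p.2) := by
  -- the finite constant
  set Ce : ℝ≥0∞ := ENNReal.ofReal (18 * Real.pi) ^ 2 *
    (12 * ∑' k : (Fin 3 → ℤ), ENNReal.ofReal ((freqNormSq k)⁻¹) ^ 2) with hCe
  set c : ℝ≥0∞ := ENNReal.ofReal (18 * Real.pi) *
    (12 * ∑' k : (Fin 3 → ℤ), ENNReal.ofReal ((freqNormSq k)⁻¹) ^ 2 + 1) with hc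
  have hctop : c ≠ ∞ := ENNReal.mul_ne_top ENNReal.ofReal_ne_top
    (ENNReal.add_ne_top.2 ⟨ENNReal.mul_ne_top (by norm_num) zConst_ne_top, ENNReal.one_ne_top⟩)
  have hCec : Ce ≤ c ^ 2 := by
    rw [hCe, hc, mul_pow]
    gcongr
    exact ennreal_le_add_one_sq _
  -- the raw map on families
  set g : W → W → ℤ × (Fin 3 → ℤ) → EuclideanSpace ℂ (Fin 3) := fun x y m =>
    Torus.lerayCoeff m.2 (𝐍[𝐜 (𝐰 x), 𝐜 (𝐰 y)] m) with hg
  have hx0 : ∀ x : W, ∀ n : ℤ, (𝐰 x) (n, 0) = 0 := fun x n => W_zero hW x n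
  have hbound : ∀ x y : W, ∑' m, ‖g x y m‖ₑ ^ 2 ≤ (c * ‖x‖ₑ * ‖y‖ₑ) ^ 2 := by
    intro x y
    calc ∑' m, ‖g x y m‖ₑ ^ 2 ≤ ∑' m, ‖𝐍[𝐜 (𝐰 x), 𝐜 (𝐰 y)] m‖ₑ ^ 2 :=
          ENNReal.tsum_le_tsum fun m => pow_le_pow_left' (SteadyLattice.enorm_lerayCoeff_le _ _) 2
      _ ≤ Ce * ((∑' m, ‖(𝐰 x) m‖ₑ ^ 2) * ∑' m, ‖(𝐰 y) m‖ₑ ^ 2) := tsum_enorm_nl_sq_le _ _ (hx0 x) (hx0 y)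
      _ = Ce * (‖x‖ₑ ^ 2 * ‖y‖ₑ ^ 2) := by
          rw [← l2_enorm_sq_eq_tsum, ← l2_enorm_sq_eq_tsum]; rfl
      _ ≤ c ^ 2 * (‖x‖ₑ ^ 2 * ‖y‖ₑ ^ 2) := by gcongr
      _ = (c * ‖x‖ₑ * ‖y‖ₑ) ^ 2 := by ring
  have hmem : ∀ x y : W, Memℓp (g x y) 2 := fun x y =>
    memℓp_two_of_tsum_ne_top (ne_top_of_le_ne_top (ENNReal.pow_ne_top
      (ENNReal.mul_ne_top (ENNReal.mul_ne_top hctop enorm_ne_top) enorm_ne_top)) (hbound x y))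
  have hV : ∀ x y : W, (∀ n : ℤ, g x y (n, 0) = 0) ∧
      (∀ mm : ℤ × (Fin 3 → ℤ), (∑ jj : Fin 3, ((mm.2 jj : ℤ) : ℂ) * (g x y mm) jj) = 0) ∧
      (∀ mm : ℤ × (Fin 3 → ℤ), g x y (-mm) = conjVec (g x y mm)) := by
    intro x y
    refine ⟨fun n => Torus.lerayCoeff_zero _, fun mm => SteadyLattice.kdot_lerayCoeff mm.2 _, fun mm => ?_⟩
    have key : 𝐍[𝐜 (𝐰 x), 𝐜 (𝐰 y)] (-mm) = conjVec (𝐍[𝐜 (𝐰 x), 𝐜 (𝐰 y)] mm) :=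
      nl_neg (𝐜 (𝐰 x)) (𝐜 (𝐰 y)) (cw_neg (W_conj hW x)) (cw_neg (W_conj hW y)) mm
    change Torus.lerayCoeff (-mm).2 (𝐍[𝐜 (𝐰 x), 𝐜 (𝐰 y)] (-mm)) =
      conjVec (Torus.lerayCoeff mm.2 (𝐍[𝐜 (𝐰 x), 𝐜 (𝐰 y)] mm))
    rw [key, Prod.snd_neg, SteadyLattice.lerayCoeff_neg_conjVec]
  set B : W → W → W := fun x y => ⟨⟨g x y, hmem x y⟩, (hW _).2 (hV x y)⟩ with hB
  have hBcoe : ∀ x y : W, 𝐰 (B x y) = g x y := fun x y => rfl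
  refine ⟨B, fun x y m => rfl, ?_⟩
  -- the real constant
  have hnorm : ∀ x y : W, ‖B x y‖ ≤ c.toReal * ‖x‖ * ‖y‖ := by
    intro x y
    rw [← norm_coeW]
    refine l2_norm_le_of_tsum_le _ (by positivity) ?_
    rw [hBcoe, ENNReal.ofReal_mul (by positivity), ENNReal.ofReal_mul ENNReal.toReal_nonneg,
      ENNReal.ofReal_toReal hctop, ofReal_norm, ofReal_norm]
    exact hbound x y
  -- summabilities for the algebra
  have hsum : ∀ (x y : W) (m : ℤ × (Fin 3 → ℤ)) (j p : Fin 3), Summable fun m' : ℤ × (Fin 3 → ℤ) =>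
      (𝐜 (𝐰 x)) m' j * (dsym j (m.2 - m'.2) * (𝐜 (𝐰 y)) (m - m') p) := fun x y m j p =>
    summable_nl_term_cw _ _ (hx0 x) (hx0 y) (l2_tsum_enorm_sq_ne_top _) (l2_tsum_enorm_sq_ne_top _) m j p
  refine { add_left := ?_, smul_left := ?_, add_right := ?_, smul_right := ?_, bound := ?_ }
  · intro x₁ x₂ y
    refine W_ext fun m => ?_
    rw [coeW_add, Pi.add_apply, hBcoe, hBcoe, hBcoe]
    change Torus.lerayCoeff m.2 (𝐍[𝐜 (𝐰 ((x₁ + x₂ : W))), 𝐜 (𝐰 y)] m) =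
      Torus.lerayCoeff m.2 (𝐍[𝐜 (𝐰 x₁), 𝐜 (𝐰 y)] m) + Torus.lerayCoeff m.2 (𝐍[𝐜 (𝐰 x₂), 𝐜 (𝐰 y)] m)
    rw [coeW_add, cw_add (𝐰 x₁) (𝐰 x₂),
      nl_add_left (𝐜 (𝐰 x₁)) (𝐜 (𝐰 x₂)) (𝐜 (𝐰 y)) m (hsum x₁ y m) (hsum x₂ y m), SteadyLattice.lerayCoeff_add']
  · intro a x y
    refine W_ext fun m => ?_
    rw [coeW_smul, Pi.smul_apply, hBcoe, hBcoe]
    change Torus.lerayCoeff m.2 (𝐍[𝐜 (𝐰 ((a • x : W))), 𝐜 (𝐰 y)] m) = a • Torus.lerayCoeff m.2 (𝐍[𝐜 (𝐰 x), 𝐜 (𝐰 y)] m)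
    rw [coeW_smul, cw_real_smul a (𝐰 x), nl_smul_left (a : ℂ) (𝐜 (𝐰 x)) (𝐜 (𝐰 y)) m,
      SteadyLattice.lerayCoeff_smul', Complex.coe_smul]
  · intro x y₁ y₂
    refine W_ext fun m => ?_
    rw [coeW_add, Pi.add_apply, hBcoe, hBcoe, hBcoe]
    change Torus.lerayCoeff m.2 (𝐍[𝐜 (𝐰 x), 𝐜 (𝐰 ((y₁ + y₂ : W)))] m) =
      Torus.lerayCoeff m.2 (𝐍[𝐜 (𝐰 x), 𝐜 (𝐰 y₁)] m) + Torus.lerayCoeff m.2 (𝐍[𝐜 (𝐰 x), 𝐜 (𝐰 y₂)] m)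
    rw [coeW_add, cw_add (𝐰 y₁) (𝐰 y₂),
      nl_add_right (𝐜 (𝐰 x)) (𝐜 (𝐰 y₁)) (𝐜 (𝐰 y₂)) m (hsum x y₁ m) (hsum x y₂ m), SteadyLattice.lerayCoeff_add']
  · intro a x y
    refine W_ext fun m => ?_
    rw [coeW_smul, Pi.smul_apply, hBcoe, hBcoe]
    change Torus.lerayCoeff m.2 (𝐍[𝐜 (𝐰 x), 𝐜 (𝐰 ((a • y : W)))] m) = a • Torus.lerayCoeff m.2 (𝐍[𝐜 (𝐰 x), 𝐜 (𝐰 y)] m)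
    rw [coeW_smul, cw_real_smul a (𝐰 y), nl_smul_right (a : ℂ) (𝐜 (𝐰 x)) (𝐜 (𝐰 y)) m,
      SteadyLattice.lerayCoeff_smul', Complex.coe_smul]
  · refine ⟨c.toReal + 1, by positivity, fun x y => (hnorm x y).trans ?_⟩
    have := mul_nonneg (mul_nonneg zero_le_one (norm_nonneg x)) (norm_nonneg y)
    nlinarith [mul_nonneg (norm_nonneg x) (norm_nonneg y)]

end BilinearMap

/-! ## §E' The time-periodic map `G(x, ω) = ω ∂ₛx + L₀ x + B(x, x)` and its strict derivative -/

section PeriodicMap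

variable {E : Type*} [NormedAddCommGroup E] [NormedSpace ℝ E]

/-- **Strict derivative of `(x, ω) ↦ ω • D x`** for a continuous linear `D`:
`(h, μ) ↦ μ • D x₀ + ω₀ • D h`. [folklore] -/
theorem hasStrictFDerivAt_smul_clm (D : E →L[ℝ] E) (x₀ : E) (ω₀ : ℝ) :
    HasStrictFDerivAt (fun p : E × ℝ => p.2 • D p.1)
      ((ContinuousLinearMap.snd ℝ E ℝ).smulRight (D x₀) + ω₀ • D.comp (ContinuousLinearMap.fst ℝ E ℝ)) (x₀, ω₀) := by
  -- `(x, ω) ↦ (ω, D x)` is linear; compose with the bounded bilinear `(ω, v) ↦ ω • v`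
  set P : E × ℝ →L[ℝ] ℝ × E := (ContinuousLinearMap.snd ℝ E ℝ).prod (D.comp (ContinuousLinearMap.fst ℝ E ℝ))
    with hP
  have hsmul : IsBoundedBilinearMap ℝ fun q : ℝ × E => q.1 • q.2 := isBoundedBilinearMap_smul
  have h1 : HasStrictFDerivAt (fun q : ℝ × E => q.1 • q.2) (hsmul.deriv (ω₀, D x₀)) (P (x₀, ω₀)) := by
    have : P (x₀, ω₀) = (ω₀, D x₀) := by simp [hP]
    rw [this]
    exact hsmul.hasStrictFDerivAt (ω₀, D x₀)
  have h2 : HasStrictFDerivAt (fun p : E × ℝ => P p) P (x₀, ω₀) := P.hasStrictFDerivAt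
  have h3 := h1.comp (x₀, ω₀) h2
  have heq : (fun p : E × ℝ => (P p).1 • (P p).2) = fun p : E × ℝ => p.2 • D p.1 := by
    funext p; simp [hP]
  have h4 : HasStrictFDerivAt (fun p : E × ℝ => p.2 • D p.1) ((hsmul.deriv (ω₀, D x₀)).comp P) (x₀, ω₀) := by
    rw [← heq]; exact h3
  refine h4.congr_fderiv (ContinuousLinearMap.ext fun p => ?_)
  obtain ⟨h, μ⟩ := p
  simp [hP, IsBoundedBilinearMap.deriv_apply, add_comm]

/-- **Strict derivative of the time-periodic map** `G(x, ω) = ω ∂ₛx + L₀ x + B(x, x)` at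
`(x₀, ω₀)`: there is a continuous linear `G'` on `E × ℝ`, the strict Fréchet derivative, with
`G'(h, μ) = μ ∂ₛx₀ + (ω₀ ∂ₛh + L₀ h + (B(x₀, h) + B(h, x₀)))` (Kielhöfer 2012, §I.8:
`D_{(x,κ)} G`). [folklore] -/
theorem exists_hasStrictFDerivAt_periodicMap (Ds L₀ : E →L[ℝ] E) {B : E → E → E}
    (hBb : IsBoundedBilinearMap ℝ (fun p : E × E => B p.1 p.2)) (x₀ : E) (ω₀ : ℝ) :
    ∃ G' : E × ℝ →L[ℝ] E,
      HasStrictFDerivAt (fun p : E × ℝ => p.2 • Ds p.1 + L₀ p.1 + B p.1 p.1) G' (x₀, ω₀) ∧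
      ∀ (h : E) (μ : ℝ), G' (h, μ) = μ • Ds x₀ + (ω₀ • Ds h + L₀ h + (B x₀ h + B h x₀)) := by
  have h1 := hasStrictFDerivAt_smul_clm Ds x₀ ω₀
  have h2 : HasStrictFDerivAt (fun p : E × ℝ => L₀ p.1) (L₀.comp (ContinuousLinearMap.fst ℝ E ℝ)) (x₀, ω₀) :=
    (L₀.comp (ContinuousLinearMap.fst ℝ E ℝ)).hasStrictFDerivAt
  have hd : HasStrictFDerivAt (fun p : E × ℝ => (p.1, p.1))
      ((ContinuousLinearMap.fst ℝ E ℝ).prod (ContinuousLinearMap.fst ℝ E ℝ)) (x₀, ω₀) :=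
    ((ContinuousLinearMap.fst ℝ E ℝ).prod (ContinuousLinearMap.fst ℝ E ℝ)).hasStrictFDerivAt
  have h3 : HasStrictFDerivAt (fun p : E × ℝ => B p.1 p.1)
      ((hBb.deriv (x₀, x₀)).comp ((ContinuousLinearMap.fst ℝ E ℝ).prod (ContinuousLinearMap.fst ℝ E ℝ))) (x₀, ω₀) :=
    HasStrictFDerivAt.comp (x₀, ω₀) (g := fun q : E × E => B q.1 q.2) (f := fun p : E × ℝ => (p.1, p.1))
      (hBb.hasStrictFDerivAt (x₀, x₀)) hd
  refine ⟨_, (h1.add h2).add h3, fun h μ => ?_⟩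
  simp only [_root_.add_apply, ContinuousLinearMap.smulRight_apply, ContinuousLinearMap.coe_snd',
    FunLike.coe_smul, Pi.smul_apply, ContinuousLinearMap.comp_apply, ContinuousLinearMap.coe_fst',
    ContinuousLinearMap.prod_apply, IsBoundedBilinearMap.deriv_apply]
  abel

end PeriodicMap

/-! ## §F' Bordered local solvability: persistence with continuous dependence of solution and frequency -/

section Bordered

variable {E : Type*} [NormedAddCommGroup E] [NormedSpace ℝ E] [CompleteSpace E]

/-- **Bordered local solvability of the time-periodic equation** (the persistence step of
Henry 1981, Ch. 8 §8.3 / Kielhöfer 2012, §I.8, on an abstract real Banach space). Let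
`G(x, ω) = ω ∂ₛx + L₀ x + B(x, x)` with `B` bounded bilinear, let `J = ω₀ ∂ₛ + L₀` be a linear
homeomorphism and `K = B(x₀, ·) + B(·, x₀)` compact, and suppose the linearisation `T = J + K`
at `(x₀, ω₀)` is NONDEGENERATE: `ker T ⊆ ℝ·g` (simple Floquet exponent `0`: hypothesis (i)) and
`∂ₛx₀ ∉ range T` (no Jordan partner: hypothesis (ii)). Then for every `δ > 0` there is `r > 0`
such that every right-hand side `y` with `‖y − G(x₀, ω₀)‖ < r` is attained, `G(x, ω) = y`, by some
`(x, ω)` with `‖x − x₀‖ < δ`, `|ω − ω₀| < δ` — solution AND frequency depend continuously on the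
force. (The bordering lemma `Literature.Analysis.Calculus.bordered_bijective` with a Hahn–Banach
functional, the open mapping theorem, and the inverse function theorem
`SteadyLattice.local_solve` for `Ψ(x, ω) = (G(x, ω), φ(x − x₀))`.) [folklore] -/
theorem bordered_local_solve (Ds L₀ : E →L[ℝ] E) {B : E → E → E}
    (hBb : IsBoundedBilinearMap ℝ (fun p : E × E => B p.1 p.2)) (x₀ : E) (ω₀ : ℝ)
    (J : E ≃L[ℝ] E) (hJ : ∀ h, J h = ω₀ • Ds h + L₀ h)
    (K : E →L[ℝ] E) (hK : ∀ h, K h = B x₀ h + B h x₀) (hKc : IsCompactOperator K)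
    (g : E) (hker : ∀ h, J h + K h = 0 → ∃ z : ℝ, h = z • g) (hrange : ∀ h, J h + K h ≠ Ds x₀)
    {δ : ℝ} (hδ : 0 < δ) :
    ∃ r : ℝ, 0 < r ∧ ∀ y : E, ‖y - (ω₀ • Ds x₀ + L₀ x₀ + B x₀ x₀)‖ < r →
      ∃ (x : E) (ω : ℝ), ω • Ds x + L₀ x + B x x = y ∧ ‖x - x₀‖ < δ ∧ |ω - ω₀| < δ := by
  -- the linearisation `T = J + K` as a continuous linear map, a compact perturbation of `J`
  set T : E →L[ℝ] E := (J : E →L[ℝ] E) + K with hT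
  have hTx : ∀ h, T h = J h + K h := fun h => rfl
  have hTK : IsCompactOperator (T - (J : E →L[ℝ] E) : E →L[ℝ] E) := by
    have : (T - (J : E →L[ℝ] E) : E →L[ℝ] E) = K := by rw [hT]; abel
    rw [this]; exact hKc
  -- `g ≠ 0` (else `T` injective, hence surjective, contradicting `hrange`), and a functional with `φ g ≠ 0`
  have hg0 : g ≠ 0 := by
    intro hg
    have hinj : Injective T := by
      rw [injective_iff_map_eq_zero]
      intro h hh
      obtain ⟨z, rfl⟩ := hker h hh
      rw [hg, smul_zero]
    obtain ⟨h, hh⟩ := (Literature.Analysis.Calculus.bijective_of_injective_of_isCompactOperator T J hTK hinj).2 (Ds x₀)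
    exact hrange h hh
  obtain ⟨φ, -, hφg⟩ := exists_dual_vector ℝ g (norm_ne_zero_iff.2 hg0)
  have hφ : φ g ≠ 0 := by rw [hφg]; exact_mod_cast norm_ne_zero_iff.2 hg0
  -- the bordered operator is bijective
  have hker' : ∀ h, T h = 0 → ∃ z : ℝ, h = z • g := fun h hh => hker h hh
  have hrange' : ∀ h, T h ≠ -Ds x₀ := by
    intro h hh
    refine hrange (-h) ?_
    rw [← hTx, map_neg, hh, neg_neg]
  have hbij := Literature.Analysis.Calculus.bordered_bijective T J hTK g (-Ds x₀) φ hker' hrange' hφ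
  -- the bordered derivative as a continuous linear map on `E × ℝ`, and the equivalence
  obtain ⟨G', hG', hG'x⟩ := exists_hasStrictFDerivAt_periodicMap Ds L₀ hBb x₀ ω₀
  set Ψ' : (E × ℝ) →L[ℝ] (E × ℝ) := G'.prod (φ.comp (ContinuousLinearMap.fst ℝ E ℝ)) with hΨ'
  have hΨ'x : ∀ p : E × ℝ, Ψ' p = (T p.1 - p.2 • (-Ds x₀), φ p.1) := by
    rintro ⟨h, μ⟩
    refine Prod.ext ?_ ?_
    · simp only [hΨ', ContinuousLinearMap.prod_apply, hG'x, hTx, hJ, hK, smul_neg, sub_neg_eq_add]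
      abel
    · simp [hΨ']
  have hΨ'bij : Bijective Ψ' := by
    have e : (Ψ' : E × ℝ → E × ℝ) = fun p : E × ℝ => (T p.1 - p.2 • (-Ds x₀), φ p.1) := funext hΨ'x
    rw [e]; exact hbij
  set L : (E × ℝ) ≃L[ℝ] (E × ℝ) := ContinuousLinearEquiv.ofBijective Ψ' (LinearMap.ker_eq_bot.2 hΨ'bij.1)
    (LinearMap.range_eq_top.2 hΨ'bij.2) with hL
  -- the bordered map and its strict derivative
  set Ψ : E × ℝ → E × ℝ := fun p => (p.2 • Ds p.1 + L₀ p.1 + B p.1 p.1, φ (p.1 - x₀)) with hΨ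
  have hΨd : HasStrictFDerivAt Ψ (L : (E × ℝ) →L[ℝ] (E × ℝ)) (x₀, ω₀) := by
    have h2 : HasStrictFDerivAt (fun p : E × ℝ => φ (p.1 - x₀)) (φ.comp (ContinuousLinearMap.fst ℝ E ℝ)) (x₀, ω₀) := by
      have ha : HasStrictFDerivAt (fun p : E × ℝ => p.1 - x₀) (ContinuousLinearMap.fst ℝ E ℝ) (x₀, ω₀) :=
        (ContinuousLinearMap.fst ℝ E ℝ).hasStrictFDerivAt.sub_const x₀
      exact φ.hasStrictFDerivAt.comp (x₀, ω₀) ha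
    have h := hG'.prodMk h2
    have e : (L : (E × ℝ) →L[ℝ] (E × ℝ)) = Ψ' := by
      ext p <;> simp [hL]
    rw [e]
    exact h
  -- local solvability by the inverse function theorem
  obtain ⟨r, hr, hsolve⟩ := SteadyLattice.local_solve hΨd hδ
  refine ⟨r, hr, fun y hy => ?_⟩
  have hdist : dist (y, (0 : ℝ)) (Ψ (x₀, ω₀)) < r := by
    have : Ψ (x₀, ω₀) = (ω₀ • Ds x₀ + L₀ x₀ + B x₀ x₀, 0) := by simp [hΨ]
    rw [this, Prod.dist_eq, dist_self, max_eq_left dist_nonneg, dist_eq_norm]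
    exact hy
  obtain ⟨⟨x, ω⟩, hxω, hd⟩ := hsolve (y, 0) hdist
  refine ⟨x, ω, ?_, ?_, ?_⟩
  · have := congrArg Prod.fst hxω
    simpa [hΨ] using this
  · have h1 : dist x x₀ < δ := lt_of_le_of_lt (by rw [Prod.dist_eq]; exact le_max_left _ _) hd
    rwa [dist_eq_norm] at h1
  · have h1 : dist ω ω₀ < δ := lt_of_le_of_lt (by rw [Prod.dist_eq]; exact le_max_right _ _) hd
    rwa [Real.dist_eq] at h1

end Bordered

end TimePeriodicLattice

end Literature.Analysis.FluidPDE
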